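import Summits.KontsevichZagierPeriods.Zeta5Search.Barrier.ConeGammaNCapCore

/-!
# ζ(5) search — BARRIER: separable integer majorants of the saving step function, finite core (kernel table)

HONEST FRAMING (cell `pub-zeta5`): systematic search; no irrationality claim unless kernel-certified. Pure finite
combinatorics (no reals) serving `ConeGammaSepMajorant` (theory seat cert-2 g33, item «SEP-MAJORANT KERNEL», INBOX plan
2026-08-27; predecessor memo `cert-2/g32/SEP-MAJORANT.md`, BARRIER-PLAN ADD. 38). Nothing here is about `ζ(5)`.

SETTING (as in `ConeGammaNCapKernel`). Ranks `0..6` (the seven weights sorted), a threshold pattern `τ ∈ taus64`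
(`heavy τ p q`), a top segment `{v | 7 ≤ v + k}` of high ranks, `W(P) = wVal` = heavy consecutive pairs + high ends of a
vertex sequence `P`. THE SEPARABLE MAJORANT FAMILY (cert-2 g32's F7/F6 are two of its 42 labelled members): for a
distinguished rank `r` (the vertex `v` of the majorant), a second rank `s ≠ r` (the vertex `w`), the bit `A = [x₀ + x_v ≥ 1]`
and the tie threshold `m` (ranks `≥ m` are the weights STRICTLY above `x_v`; ranks in `(r, m)` are tied with `v`),

  `max_P W(P) + A + [m ≤ s] + m ≤ 8 + [r high] + deg_heavy(r) + [heavy r s]`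

whenever the data are CONSISTENT with a point `x₀` (`A = 0 ⇒` every heavy neighbour of `r` is high; `A = 1 ⇒` every high
rank `≠ r` is a heavy neighbour of `r`) and with the ties (ranks in `(r, m)` carry `r`'s heavy row and high bit).

* `sepRowsC0 … sepRowsC7`, `sepRows` — DATA: for each pattern of `taus64` the eight maxima `M_k = max_P W` (`k = 0..7`);
  `sepRows_map_fst` — the patterns are `taus64` in order; `checkMax` + `sepChunk0..7` (`decide +kernel`, eight chunks as in
  `ConeGammaNCapKernel`) — the stored maxima dominate `maxW ∘ endTable`; `wVal_le_maxW`.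
* `hdeg`, `sepOK` (consistency + ties, Boolean), `sepIneq`, `checkLab`, `checkLab_all` (`decide`) — the labelled inequality
  holds in every consistent case (41,460 cases; minimum slack 0).
* **`wVal_le_sepBound`** — the abstract statement for a symmetric doubly-monotone pair marking and a monotone end marking.
-/

namespace Summit.KontsevichZagierPeriods.Zeta5Search.Barrier.ConeGamma.NCap

/-! ### Data: the maxima of `W` per threshold pattern and top segment -/

/-- rows 0–7: `(τ, [M₀,…,M₇])`, `M_k = max_P W` for the top segment of size `k` -/
def sepRowsC0 : List (List ℕ × List ℕ) :=
  [([1, 2, 3, 4, 5, 6, 7], [6, 7, 8, 8, 8, 8, 8, 8]),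
   ([2, 2, 3, 4, 5, 6, 7], [6, 7, 8, 8, 8, 8, 8, 8]),
   ([3, 2, 3, 4, 5, 6, 7], [6, 7, 8, 8, 8, 8, 8, 8]),
   ([3, 3, 3, 4, 5, 6, 7], [6, 7, 8, 8, 8, 8, 8, 8]),
   ([4, 2, 3, 4, 5, 6, 7], [6, 7, 8, 8, 8, 8, 8, 8]),
   ([4, 3, 3, 4, 5, 6, 7], [6, 7, 8, 8, 8, 8, 8, 8]),
   ([4, 4, 3, 4, 5, 6, 7], [6, 7, 7, 7, 8, 8, 8, 8]),
   ([4, 4, 4, 4, 5, 6, 7], [6, 6, 6, 6, 7, 8, 8, 8])]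
/-- rows 8–15: `(τ, [M₀,…,M₇])`, `M_k = max_P W` for the top segment of size `k` -/
def sepRowsC1 : List (List ℕ × List ℕ) :=
  [([5, 2, 3, 4, 5, 6, 7], [6, 7, 7, 8, 8, 8, 8, 8]),
   ([5, 3, 3, 4, 5, 6, 7], [6, 7, 7, 8, 8, 8, 8, 8]),
   ([5, 4, 3, 4, 5, 6, 7], [6, 7, 7, 7, 8, 8, 8, 8]),
   ([5, 4, 4, 4, 5, 6, 7], [6, 6, 6, 6, 7, 8, 8, 8]),
   ([5, 5, 3, 4, 5, 6, 7], [6, 6, 6, 7, 7, 7, 8, 8]),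
   ([5, 5, 4, 4, 5, 6, 7], [6, 6, 6, 6, 7, 7, 8, 8]),
   ([5, 5, 5, 4, 5, 6, 7], [5, 5, 5, 6, 6, 7, 7, 7]),
   ([5, 5, 5, 5, 5, 6, 7], [4, 4, 4, 5, 6, 6, 6, 6])]
/-- rows 16–23: `(τ, [M₀,…,M₇])`, `M_k = max_P W` for the top segment of size `k` -/
def sepRowsC2 : List (List ℕ × List ℕ) :=
  [([6, 2, 3, 4, 5, 6, 7], [6, 6, 7, 7, 7, 7, 7, 8]),
   ([6, 3, 3, 4, 5, 6, 7], [6, 6, 7, 7, 7, 7, 7, 8]),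
   ([6, 4, 3, 4, 5, 6, 7], [6, 6, 7, 7, 7, 7, 7, 8]),
   ([6, 4, 4, 4, 5, 6, 7], [6, 6, 6, 6, 7, 7, 7, 8]),
   ([6, 5, 3, 4, 5, 6, 7], [6, 6, 6, 7, 7, 7, 7, 8]),
   ([6, 5, 4, 4, 5, 6, 7], [6, 6, 6, 6, 7, 7, 7, 8]),
   ([6, 5, 5, 4, 5, 6, 7], [5, 5, 5, 6, 6, 7, 7, 7]),
   ([6, 5, 5, 5, 5, 6, 7], [4, 4, 4, 5, 6, 6, 6, 6])]
/-- rows 24–31: `(τ, [M₀,…,M₇])`, `M_k = max_P W` for the top segment of size `k` -/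
def sepRowsC3 : List (List ℕ × List ℕ) :=
  [([6, 6, 3, 4, 5, 6, 7], [5, 5, 6, 6, 6, 6, 7, 7]),
   ([6, 6, 4, 4, 5, 6, 7], [5, 5, 6, 6, 6, 6, 7, 7]),
   ([6, 6, 5, 4, 5, 6, 7], [5, 5, 5, 6, 6, 6, 7, 7]),
   ([6, 6, 5, 5, 5, 6, 7], [4, 4, 4, 5, 6, 6, 6, 6]),
   ([6, 6, 6, 4, 5, 6, 7], [4, 4, 5, 5, 5, 6, 6, 6]),
   ([6, 6, 6, 5, 5, 6, 7], [4, 4, 4, 5, 5, 6, 6, 6]),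
   ([6, 6, 6, 6, 5, 6, 7], [3, 3, 4, 4, 5, 5, 5, 5]),
   ([6, 6, 6, 6, 6, 6, 7], [2, 2, 3, 4, 4, 4, 4, 4])]
/-- rows 32–39: `(τ, [M₀,…,M₇])`, `M_k = max_P W` for the top segment of size `k` -/
def sepRowsC4 : List (List ℕ × List ℕ) :=
  [([7, 2, 3, 4, 5, 6, 7], [5, 6, 6, 6, 6, 6, 6, 7]),
   ([7, 3, 3, 4, 5, 6, 7], [5, 6, 6, 6, 6, 6, 6, 7]),
   ([7, 4, 3, 4, 5, 6, 7], [5, 6, 6, 6, 6, 6, 6, 7]),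
   ([7, 4, 4, 4, 5, 6, 7], [5, 6, 6, 6, 6, 6, 6, 7]),
   ([7, 5, 3, 4, 5, 6, 7], [5, 6, 6, 6, 6, 6, 6, 7]),
   ([7, 5, 4, 4, 5, 6, 7], [5, 6, 6, 6, 6, 6, 6, 7]),
   ([7, 5, 5, 4, 5, 6, 7], [5, 5, 5, 6, 6, 6, 6, 7]),
   ([7, 5, 5, 5, 5, 6, 7], [4, 4, 4, 5, 6, 6, 6, 6])]
/-- rows 40–47: `(τ, [M₀,…,M₇])`, `M_k = max_P W` for the top segment of size `k` -/
def sepRowsC5 : List (List ℕ × List ℕ) :=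
  [([7, 6, 3, 4, 5, 6, 7], [5, 5, 6, 6, 6, 6, 6, 7]),
   ([7, 6, 4, 4, 5, 6, 7], [5, 5, 6, 6, 6, 6, 6, 7]),
   ([7, 6, 5, 4, 5, 6, 7], [5, 5, 5, 6, 6, 6, 6, 7]),
   ([7, 6, 5, 5, 5, 6, 7], [4, 4, 4, 5, 6, 6, 6, 6]),
   ([7, 6, 6, 4, 5, 6, 7], [4, 4, 5, 5, 5, 6, 6, 6]),
   ([7, 6, 6, 5, 5, 6, 7], [4, 4, 4, 5, 5, 6, 6, 6]),
   ([7, 6, 6, 6, 5, 6, 7], [3, 3, 4, 4, 5, 5, 5, 5]),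
   ([7, 6, 6, 6, 6, 6, 7], [2, 2, 3, 4, 4, 4, 4, 4])]
/-- rows 48–55: `(τ, [M₀,…,M₇])`, `M_k = max_P W` for the top segment of size `k` -/
def sepRowsC6 : List (List ℕ × List ℕ) :=
  [([7, 7, 3, 4, 5, 6, 7], [4, 5, 5, 5, 5, 5, 6, 6]),
   ([7, 7, 4, 4, 5, 6, 7], [4, 5, 5, 5, 5, 5, 6, 6]),
   ([7, 7, 5, 4, 5, 6, 7], [4, 5, 5, 5, 5, 5, 6, 6]),
   ([7, 7, 5, 5, 5, 6, 7], [4, 4, 4, 5, 5, 5, 6, 6]),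
   ([7, 7, 6, 4, 5, 6, 7], [4, 4, 5, 5, 5, 5, 6, 6]),
   ([7, 7, 6, 5, 5, 6, 7], [4, 4, 4, 5, 5, 5, 6, 6]),
   ([7, 7, 6, 6, 5, 6, 7], [3, 3, 4, 4, 5, 5, 5, 5]),
   ([7, 7, 6, 6, 6, 6, 7], [2, 2, 3, 4, 4, 4, 4, 4])]
/-- rows 56–63: `(τ, [M₀,…,M₇])`, `M_k = max_P W` for the top segment of size `k` -/
def sepRowsC7 : List (List ℕ × List ℕ) :=
  [([7, 7, 7, 4, 5, 6, 7], [3, 4, 4, 4, 4, 5, 5, 5]),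
   ([7, 7, 7, 5, 5, 6, 7], [3, 4, 4, 4, 4, 5, 5, 5]),
   ([7, 7, 7, 6, 5, 6, 7], [3, 3, 4, 4, 4, 5, 5, 5]),
   ([7, 7, 7, 6, 6, 6, 7], [2, 2, 3, 4, 4, 4, 4, 4]),
   ([7, 7, 7, 7, 5, 6, 7], [2, 3, 3, 3, 4, 4, 4, 4]),
   ([7, 7, 7, 7, 6, 6, 7], [2, 2, 3, 3, 4, 4, 4, 4]),
   ([7, 7, 7, 7, 7, 6, 7], [1, 2, 2, 3, 3, 3, 3, 3]),
   ([7, 7, 7, 7, 7, 7, 7], [0, 1, 2, 2, 2, 2, 2, 2])]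

/-- The table: 64 rows `(τ, [M₀,…,M₇])`. -/
def sepRows : List (List ℕ × List ℕ) :=
  sepRowsC0 ++ sepRowsC1 ++ sepRowsC2 ++ sepRowsC3 ++ sepRowsC4 ++ sepRowsC5 ++ sepRowsC6 ++ sepRowsC7

/-- The patterns of the table are the 64 threshold patterns `taus64`, in order. -/
theorem sepRows_map_fst : sepRows.map Prod.fst = taus64 := by decide

/-- Row check: the stored maxima dominate `maxW (endTable (heavy τ)) k` for `k = 0..7`. -/
def checkMax (row : List ℕ × List ℕ) : Bool :=
  (List.range 8).all fun k => decide (maxW (endTable (heavy row.1)) k ≤ row.2.getD k 0)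

/-! ### The kernel certificate of the maxima (eight chunks; one chunk of 64 exceeds the kernel budget) -/

set_option maxHeartbeats 4000000 in
/-- chunk 0 -/ theorem sepChunk0 : sepRowsC0.all checkMax = true := by decide +kernel
set_option maxHeartbeats 4000000 in
/-- chunk 1 -/ theorem sepChunk1 : sepRowsC1.all checkMax = true := by decide +kernel
set_option maxHeartbeats 4000000 in
/-- chunk 2 -/ theorem sepChunk2 : sepRowsC2.all checkMax = true := by decide +kernel
set_option maxHeartbeats 4000000 in
/-- chunk 3 -/ theorem sepChunk3 : sepRowsC3.all checkMax = true := by decide +kernel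
set_option maxHeartbeats 4000000 in
/-- chunk 4 -/ theorem sepChunk4 : sepRowsC4.all checkMax = true := by decide +kernel
set_option maxHeartbeats 4000000 in
/-- chunk 5 -/ theorem sepChunk5 : sepRowsC5.all checkMax = true := by decide +kernel
set_option maxHeartbeats 4000000 in
/-- chunk 6 -/ theorem sepChunk6 : sepRowsC6.all checkMax = true := by decide +kernel
set_option maxHeartbeats 4000000 in
/-- chunk 7 -/ theorem sepChunk7 : sepRowsC7.all checkMax = true := by decide +kernel

/-- **Every row of the table passes the maxima check.** -/
theorem checkMax_of_mem {row : List ℕ × List ℕ} (h : row ∈ sepRows) : checkMax row = true := by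
  have hall : sepRows.all checkMax = true := by
    simp only [sepRows, List.all_append, sepChunk0, sepChunk1, sepChunk2, sepChunk3, sepChunk4, sepChunk5, sepChunk6,
      sepChunk7, Bool.and_self]
  exact List.all_eq_true.mp hall row h

/-! ### The labelled inequality in every consistent case -/

/-- Heavy degree of the rank `r`: `#{q < 7, q ≠ r, hv r q}`. -/
def hdeg (hv : ℕ → ℕ → Bool) (r : ℕ) : ℕ := ((List.range 7).filter fun q => q != r && hv r q).length

/-- CONSISTENCY of the labelled data `(k, r, s, m, A)` with a pair marking `hv` (Boolean): `r ≠ s`, `r < m`, and for every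
rank `q ≠ r`: `A = 0 ⇒ (hv r q ⇒ q high)`, `A = 1 ⇒ (q high ⇒ hv r q)`, and the TIE clause for `r < q < m`: `q` has
`r`'s high bit and `r`'s heavy row. -/
def sepOK (hv : ℕ → ℕ → Bool) (k r s m : ℕ) (A : Bool) : Bool :=
  (r != s) && decide (r < m) &&
    (List.range 7).all fun q => (q == r) ||
      ((A || !hv r q || decide (7 ≤ q + k)) && (!A || !decide (7 ≤ q + k) || hv r q) &&
        (!(decide (r < q) && decide (q < m)) ||
          ((decide (7 ≤ q + k) == decide (7 ≤ r + k)) &&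
            (List.range 7).all fun p => (p == q) || (p == r) || (hv q p == hv r p))))

/-- The labelled inequality `M + A + [m ≤ s] + m ≤ 8 + [r high] + deg(r) + [hv r s]` (Boolean). -/
def sepIneq (hv : ℕ → ℕ → Bool) (M k r s m : ℕ) (A : Bool) : Bool :=
  decide (M + (if A then 1 else 0) + (if m ≤ s then 1 else 0) + m ≤
    8 + (if 7 ≤ r + k then 1 else 0) + hdeg hv r + (if hv r s then 1 else 0))

/-- Row check: the labelled inequality in every consistent case `(k, r, s, m, A)`. -/
def checkLab (row : List ℕ × List ℕ) : Bool :=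
  (List.range 8).all fun k => (List.range 7).all fun r => (List.range 7).all fun s =>
    (List.range 8).all fun m => [true, false].all fun A =>
      !sepOK (heavy row.1) k r s m A || sepIneq (heavy row.1) (row.2.getD k 0) k r s m A

set_option maxHeartbeats 4000000 in
/-- **Every row passes the labelled check** (41,460 consistent cases in all; minimum slack 0). -/
theorem checkLab_all : sepRows.all checkLab = true := by decide +kernel

/-- The labelled inequality at a consistent case of a row of the table. -/
theorem sepIneq_of_mem {row : List ℕ × List ℕ} (h : row ∈ sepRows) {k r s m : ℕ} {A : Bool} (hk : k < 8) (hr : r < 7)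
    (hs : s < 7) (hm : m < 8) (hok : sepOK (heavy row.1) k r s m A = true) :
    sepIneq (heavy row.1) (row.2.getD k 0) k r s m A = true := by
  have h1 := List.all_eq_true.mp checkLab_all row h
  unfold checkLab at h1
  have h2 := List.all_eq_true.mp (List.all_eq_true.mp (List.all_eq_true.mp (List.all_eq_true.mp (List.all_eq_true.mp h1
    k (List.mem_range.mpr hk)) r (List.mem_range.mpr hr)) s (List.mem_range.mpr hs)) m (List.mem_range.mpr hm)) A
    (by cases A <;> simp)
  rw [hok] at h2
  simpa using h2

/-! ### `max_P W` is dominated by the table -/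

/-- Every Hamiltonian path of `{0..6}` has `W ≤ maxW` (the upper half of `wVal_sub_le_five_of_checkTau`'s argument). -/
theorem wVal_le_maxW (τ : List ℕ) (k : ℕ) {P : List ℕ} (hP : P.Perm (List.range 7)) :
    wVal (heavy τ) (fun v => decide (7 ≤ v + k)) P ≤ maxW (endTable (heavy τ)) k := by
  obtain ⟨a, b, mid, rfl, hab, ha, hb, hmid⟩ := exists_decomp hP
  rcases lt_or_gt_of_ne hab with h | h
  · rw [wVal_cons_append]
    exact (wVal_mem_bounds (heavy τ) k a b h hb mid hmid).2
  · have hrev : (a :: (mid ++ [b])).reverse = b :: (mid.reverse ++ [a]) := by simp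
    rw [← wVal_reverse (heavy τ) _ (heavy_symm τ), hrev, wVal_cons_append]
    have hmid' : mid.reverse.Perm (interior b a) := by
      rw [interior_comm]; exact (List.reverse_perm mid).trans hmid
    exact (wVal_mem_bounds (heavy τ) k b a h ha mid.reverse hmid').2

/-- For a pattern of `taus64`: `W(P) ≤ M_k` with `M_k` the table entry. -/
theorem exists_row_of_mem_taus64 {τ : List ℕ} (hτ : τ ∈ taus64) : ∃ row ∈ sepRows, row.1 = τ := by
  rw [← sepRows_map_fst, List.mem_map] at hτ
  obtain ⟨row, hrow, rfl⟩ := hτ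
  exact ⟨row, hrow, rfl⟩

/-- The table bound: `W(P) ≤ M_k`. -/
theorem wVal_le_row {row : List ℕ × List ℕ} (h : row ∈ sepRows) {k : ℕ} (hk : k < 8) {P : List ℕ}
    (hP : P.Perm (List.range 7)) : wVal (heavy row.1) (fun v => decide (7 ≤ v + k)) P ≤ row.2.getD k 0 := by
  have h1 := List.all_eq_true.mp (checkMax_of_mem h) k (List.mem_range.mpr hk)
  exact le_trans (wVal_le_maxW row.1 k hP) (of_decide_eq_true h1)

/-! ### The abstract separable bound -/

/-- Introduction rule for `sepOK` from propositional data. -/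
theorem sepOK_of (hv : ℕ → ℕ → Bool) {k r s m : ℕ} {A : Bool} (hrs : r ≠ s) (hrm : r < m)
    (hC2 : A = false → ∀ q, q < 7 → q ≠ r → hv r q = true → 7 ≤ q + k)
    (hC3 : A = true → ∀ q, q < 7 → q ≠ r → 7 ≤ q + k → hv r q = true)
    (htie : ∀ q, q < 7 → r < q → q < m →
      (7 ≤ q + k ↔ 7 ≤ r + k) ∧ ∀ p, p < 7 → p ≠ q → p ≠ r → hv q p = hv r p) :
    sepOK hv k r s m A = true := by
  unfold sepOK
  simp only [Bool.and_eq_true, bne_iff_ne, ne_eq, decide_eq_true_eq, List.all_eq_true, List.mem_range,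
    Bool.or_eq_true, beq_iff_eq, Bool.not_eq_true', Bool.not_and, decide_eq_false_iff_not, not_lt]
  refine ⟨⟨hrs, hrm⟩, fun q hq => ?_⟩
  by_cases hqr : q = r
  · exact Or.inl hqr
  · refine Or.inr ⟨⟨?_, ?_⟩, ?_⟩
    · -- `A || !hv r q || high q`
      cases hA : A
      · by_cases hh : hv r q = true
        · exact Or.inr (hC2 hA q hq hqr hh)
        · exact Or.inl (Or.inr (by simpa using hh))
      · exact Or.inl (Or.inl rfl)
    · -- `!A || !high q || hv r q`
      cases hA : A
      · exact Or.inl (Or.inl rfl)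
      · by_cases hh : 7 ≤ q + k
        · exact Or.inr (hC3 hA q hq hqr hh)
        · exact Or.inl (Or.inr hh)
    · -- ties
      by_cases hrq : r < q
      · by_cases hqm : q < m
        · obtain ⟨h1, h2⟩ := htie q hq hrq hqm
          refine Or.inr ⟨?_, fun p hp => ?_⟩
          · by_cases h7 : 7 ≤ q + k
            · rw [decide_eq_true h7, decide_eq_true (h1.mp h7)]
            · rw [decide_eq_false h7, decide_eq_false (fun h => h7 (h1.mpr h))]
          · by_cases hpq : p = q
            · exact Or.inl (Or.inl hpq)
            · by_cases hpr : p = r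
              · exact Or.inl (Or.inr hpr)
              · exact Or.inr (h2 p hp hpq hpr)
        · exact Or.inl (Or.inr (not_lt.mp hqm))
      · exact Or.inl (Or.inl (not_lt.mp hrq))

/-- `hdeg` only looks at `hv r q` for `q < 7`, `q ≠ r`. -/
theorem hdeg_congr (hv hv' : ℕ → ℕ → Bool) (r : ℕ) (h : ∀ q, q < 7 → q ≠ r → hv r q = hv' r q) :
    hdeg hv r = hdeg hv' r := by
  unfold hdeg
  congr 1
  apply List.filter_congr
  intro q hq
  rw [List.mem_range] at hq
  by_cases hqr : q = r
  · simp [hqr]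
  · rw [h q hq hqr]

/-- **THE ABSTRACT SEPARABLE BOUND.** For a symmetric pair marking `hv` of `{0..6}` monotone in both arguments and a monotone
end marking `hi`, ranks `r ≠ s`, a tie threshold `m > r` and a bit `A` CONSISTENT with the markings (`A = false ⇒` heavy
neighbours of `r` are high; `A = true ⇒` high ranks `≠ r` are heavy neighbours of `r`; ranks in `(r, m)` carry `r`'s high
bit and heavy row): `W(P) + A + [m ≤ s] + m ≤ 8 + [hi r] + deg(r) + [hv r s]` for every Hamiltonian path `P` of `{0..6}`. -/
theorem wVal_le_sepBound (hv : ℕ → ℕ → Bool) (hi : ℕ → Bool)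
    (hsym : ∀ p q, hv p q = hv q p)
    (hrow : ∀ p q q', p < q → q ≤ q' → q' < 7 → hv p q = true → hv p q' = true)
    (hcol : ∀ p p' q, p ≤ p' → p' < q → q < 7 → hv p q = true → hv p' q = true)
    (hhi : ∀ v v', v ≤ v' → v' < 7 → hi v = true → hi v' = true)
    {r s m : ℕ} {A : Bool} (hr : r < 7) (hs : s < 7) (hm : m ≤ 7) (hrs : r ≠ s) (hrm : r < m)
    (hC2 : A = false → ∀ q, q < 7 → q ≠ r → hv r q = true → hi q = true)
    (hC3 : A = true → ∀ q, q < 7 → q ≠ r → hi q = true → hv r q = true)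
    (htie : ∀ q, q < 7 → r < q → q < m → hi q = hi r ∧ ∀ p, p < 7 → p ≠ q → p ≠ r → hv q p = hv r p)
    {P : List ℕ} (hP : P.Perm (List.range 7)) :
    wVal hv hi P + (if A then 1 else 0) + (if m ≤ s then 1 else 0) + m ≤
      8 + (if hi r then 1 else 0) + hdeg hv r + (if hv r s then 1 else 0) := by
  -- the end marking is the top segment `{v | 7 ≤ v + k}`
  set m₀ := firstFrom hi 0 7 with hm₀
  have hm₀7 : m₀ ≤ 7 := firstFrom_le hi 7 0
  set k := 7 - m₀ with hk
  have hk8 : k < 8 := by omega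
  have hiseg : ∀ v, v < 7 → hi v = decide (7 ≤ v + k) := by
    intro v hv7
    rw [eq_decide_firstFrom_le hi 0 (fun q q' _ h2 h3 h4 => hhi q q' h2 h3 h4) (Nat.zero_le v) hv7]
    by_cases h : firstFrom hi 0 7 ≤ v
    · rw [decide_eq_true h, decide_eq_true (by omega)]
    · rw [decide_eq_false h, decide_eq_false (by omega)]
  have hiseg' : ∀ v, v < 7 → (hi v = true ↔ 7 ≤ v + k) := fun v hv7 => by
    rw [hiseg v hv7]; exact decide_eq_true_iff
  -- the pair marking is `heavy τ`, `τ ∈ taus64`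
  have hτ := tauList_mem_taus64 hv hrow hcol
  obtain ⟨row, hrow_mem, hrow1⟩ := exists_row_of_mem_taus64 hτ
  have heq : ∀ p q, p < 7 → q < 7 → p ≠ q → heavy row.1 p q = hv p q := fun p q hp hq hpq => by
    rw [hrow1]; exact heavy_tauList_eq hv hsym hrow hp hq hpq
  -- (1) `W(P) ≤ M_k`
  have hmemP : ∀ a ∈ P, a < 7 := fun a ha => List.mem_range.mp (hP.mem_iff.mp ha)
  have hW : wVal hv hi P = wVal (heavy row.1) (fun v => decide (7 ≤ v + k)) P :=
    wVal_congr _ _ _ _ (hP.nodup_iff.mpr List.nodup_range)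
      (fun a ha b hb hab => (heq a b (hmemP a ha) (hmemP b hb) hab).symm) (fun a ha => hiseg a (hmemP a ha))
  have h1 : wVal hv hi P ≤ row.2.getD k 0 := by rw [hW]; exact wVal_le_row hrow_mem hk8 hP
  -- (2) the labelled inequality at `(k, r, s, m, A)`
  have hok : sepOK (heavy row.1) k r s m A = true := by
    refine sepOK_of (heavy row.1) hrs hrm (fun hA q hq hqr hh => ?_) (fun hA q hq hqr hh => ?_)
      (fun q hq hrq hqm => ⟨?_, fun p hp hpq hpr => ?_⟩)
    · exact (hiseg' q hq).mp (hC2 hA q hq hqr (by rwa [heq r q hr hq (Ne.symm hqr)] at hh))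
    · rw [heq r q hr hq (Ne.symm hqr)]; exact hC3 hA q hq hqr ((hiseg' q hq).mpr hh)
    · rw [← hiseg' q hq, ← hiseg' r hr, (htie q hq hrq hqm).1]
    · rw [heq q p hq hp (Ne.symm hpq), heq r p hr hp (Ne.symm hpr)]
      exact (htie q hq hrq hqm).2 p hp hpq hpr
  have h2 := sepIneq_of_mem hrow_mem hk8 hr hs (by omega) hok
  unfold sepIneq at h2
  have h3 := of_decide_eq_true h2
  -- (3) translate back to `hv`, `hi`
  have hdg : hdeg (heavy row.1) r = hdeg hv r := hdeg_congr _ _ r fun q hq hqr => heq r q hr hq (Ne.symm hqr)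
  have hrs' : heavy row.1 r s = hv r s := heq r s hr hs hrs
  have hir : (if hi r then 1 else 0 : ℕ) = if 7 ≤ r + k then 1 else 0 := by
    rw [hiseg r hr]
    by_cases h : 7 ≤ r + k
    · rw [decide_eq_true h, if_pos rfl, if_pos h]
    · rw [decide_eq_false h, if_neg (by simp), if_neg h]
  rw [hdg, hrs'] at h3
  rw [hir]
  omega

end Summit.KontsevichZagierPeriods.Zeta5Search.Barrier.ConeGamma.NCap
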